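import Summits.QuantumFields.YangMills.Theorems.AllWindowsColdBoxBoxHighLinePlaquetteEdgeMoments
import Summits.QuantumFields.YangMills.Theorems.AllWindowsColdBoxBoxHighLineActionSandwichPlaquetteCost
import Summits.QuantumFields.YangMills.Theorems.AllWindowsColdBoxBoxHighLineQuadFormSplit
import Summits.QuantumFields.YangMills.Theorems.AllWindowsColdBoxBoxHighLineSmallFieldSmallPlaquettes

/-!
# T-S5.12d «PlaquetteObsL2» — Gaussian `L²` sizes of one plaquette observable: `E₀[(c_p⁽²⁾)²] ≲ β⁻²`, `E₀[(c_p^{odd})²] ≲ β⁻³`,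
# `E₀[(c_p − c_p⁽²⁾ − c_p^{odd})²] ≲ β⁻⁴` (the last one modulo T-S5.7a `WilsonPlaquetteTaylor`)

Brick T-S5.12d of the WICK LAYER (✓`…Step2Wick`, planner ym-idea-2 g18) for STEP 2 of the XL stub S5 (LINE-19, ⟨stmt-QuantumFields-24004⟩/⟨24335⟩):

  `plaquetteObsL2_of (h7a : WilsonPlaquetteTaylor) : PlaquetteObsL2`

— clause (i) is ✓`PlaqObsL4.gaussAvg_linCurvSq_sq_le` (`15/4·β⁻²`); clause (ii) is UNCONDITIONAL (`gaussAvg_chartPlaqCostOdd_sq_le`): from w2's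
✓`PlaqCost.abs_plaquetteCost_sub_dot_le` (second-order expansion of the plaquette cost around the sinc-rescaled circulation `s`, whose square is
EVEN in `a`) the odd part obeys `|c_p^{odd}| ≤ 32t³ + 44t⁴` on `‖v_i‖ ≤ t ≤ 1` and `|c_p^{odd}| ≤ 4` always (✓`abs_plaquetteObs_le_holds`), hence the
pointwise dominator `(c_p^{odd})² ≤ 5776·S³ ≤ 2888(β⁻¹S² + βS⁴)`, `S = Σ_i‖v_i‖²`, and ✓`…PlaquetteEdgeMoments` (`E₀[S²] ≲ β⁻²`, `E₀[S⁴] ≲ β⁻⁴` by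
hypercontractivity); clause (iii) needs the EVEN quartic expansion `|c_p − |ℓ_p|² − c_p^{odd}| ≤ C t⁴`, which is exactly the first clause of
T-S5.7a `WilsonPlaquetteTaylor` (w2's lineage) — taken here as a hypothesis BY NAME (nothing of 7a is restated): dominator `R² ≤ (C² + 144)·S⁴`.

Tree + Mathlib only; no definitions.  HONEST LABEL: one S brick of STEP 2 of the XL stub S5 of a critic-PASSed DRAFT line, conditional on the open
task 7a; 7a, S5, U5, ⟨stmt-QuantumFields-24004⟩ ⟨24335⟩ ⟨24336⟩ remain OPEN; route AllWindowsColdBox is DRAFT; **the Yang–Mills mass gap is NOT proved by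
this file; no summit is proved by a line.**  Seat ym-line-sfw-p2-w5 g22 (EXTRA WIDTH seat w5, cell ym-idea-1).
-/

set_option autoImplicit false

noncomputable section

open MeasureTheory Matrix Finset
open Literature.Probability.LatticeModels (Site)
open Literature.MathematicalPhysics.QuantumLattice (ZdEdge fundamentalRep)
open Literature.MathematicalPhysics.QuantumFieldTheory.Balaban1983to89.B10Eq18SigmaSU2Haar (expPauli)
open Summit.QuantumFields.YangMills.Theorems.WeakCouplingRates (plaq12At)

namespace Summit.QuantumFields.YangMills.Theorems.AllWindowsColdBoxBoxHighLine

namespace PlaqObsL2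

variable (H : ℕ) (x : Site 4) (μ ν : Fin 4)

/-! ## The plaquette cost in the chart as a function of the four edge variables -/

/-- The edge variables are odd in the field: `plaqVar H x μ ν (−a) = −plaqVar H x μ ν a`. -/
theorem plaqVar_neg (a : LandauFree H → E3) (i : Fin 4) : plaqVar H x μ ν (-a) i = -plaqVar H x μ ν a i := by
  unfold plaqVar freeVec
  split_ifs <;> simp

/-- The plaquette cost in the chart, unfolded: `c_p(a) = 2 − Re tr(e^{v₀} e^{v₁} e^{−v₂} e^{−v₃})`, `v = plaqVar H x μ ν a`, `e^{v} = expPauli v`. -/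
theorem chartPlaqCost_eq_cost (a : LandauFree H → E3) :
    chartPlaqCost H x μ ν a = 2 - (((expPauli (plaqVar H x μ ν a 0) * expPauli (plaqVar H x μ ν a 1) *
      (expPauli (plaqVar H x μ ν a 2))⁻¹ * (expPauli (plaqVar H x μ ν a 3))⁻¹ : SU2) : Matrix (Fin 2) (Fin 2) ℂ)).trace.re := by
  unfold chartPlaqCost Summit.QuantumFields.YangMills.Theorems.WeakCouplingRates.plaqCostAt
    Literature.MathematicalPhysics.QuantumLattice.plaquetteObs Literature.MathematicalPhysics.QuantumLattice.plaquetteHolonomyZd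
  simp only [plaqVar, plaqEdge, edgeChart, Matrix.cons_val_zero, Matrix.cons_val_one]
  norm_num
  rfl

/-- `|c_p| ≤ 4` (a `2 × 2` unitary has `|Re tr| ≤ 2`). -/
theorem abs_chartPlaqCost_le (a : LandauFree H → E3) : |chartPlaqCost H x μ ν a| ≤ 4 := by
  have h := Literature.MathematicalPhysics.QuantumLattice.abs_plaquetteObs_le_holds (d := 4) (fundamentalRep (Fin 2))
    Literature.MathematicalPhysics.QuantumLattice.fundamentalRep_mem_unitaryGroup x μ ν (edgeChart H a)
  unfold chartPlaqCost Summit.QuantumFields.YangMills.Theorems.WeakCouplingRates.plaqCostAt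
  have h' : |Literature.MathematicalPhysics.QuantumLattice.plaquetteObs (fundamentalRep (Fin 2)) x μ ν (edgeChart H a)| ≤ 2 := by
    simpa using h
  have := abs_le.mp h'
  rw [abs_le]; constructor <;> push_cast <;> linarith [this.1, this.2]

/-- `|c_p^{odd}| ≤ 4`. -/
theorem abs_chartPlaqCostOdd_le_four (a : LandauFree H → E3) : |chartPlaqCostOdd H x μ ν a| ≤ 4 := by
  unfold chartPlaqCostOdd
  have h1 := abs_chartPlaqCost_le H x μ ν a
  have h2 := abs_chartPlaqCost_le H x μ ν (-a)
  rw [abs_le] at h1 h2 ⊢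
  constructor <;> linarith [h1.1, h1.2, h2.1, h2.2]

/-! ## The sinc-rescaled circulation and its square (even in `a`) -/

/-- `|sinc‖v‖·v|² ≤ ‖v‖²`. -/
theorem sinc_smul_dotProduct_self_le (v : E3) :
    (Real.sinc ‖v‖ • WithLp.ofLp v) ⬝ᵥ (Real.sinc ‖v‖ • WithLp.ofLp v) ≤ ‖v‖ ^ 2 := by
  rw [smul_dotProduct, dotProduct_smul, smul_eq_mul, smul_eq_mul, SmallFieldPlaq.dotProduct_self_eq_norm_sq, ← mul_assoc]
  have h1 : Real.sinc ‖v‖ * Real.sinc ‖v‖ ≤ 1 := by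
    have h := Real.abs_sinc_le_one ‖v‖
    have := abs_le.mp h
    nlinarith
  nlinarith [sq_nonneg ‖v‖]

/-- **The square of the sinc-circulation is at most `16t²`** when all four edge variables have norm `≤ t`. -/
theorem sincCirc_dotProduct_self_le (v : Fin 4 → E3) {t : ℝ} (hv : ∀ i, ‖v i‖ ≤ t) :
    (Real.sinc ‖v 0‖ • WithLp.ofLp (v 0) + Real.sinc ‖v 1‖ • WithLp.ofLp (v 1) - Real.sinc ‖v 2‖ • WithLp.ofLp (v 2)
        - Real.sinc ‖v 3‖ • WithLp.ofLp (v 3)) ⬝ᵥ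
      (Real.sinc ‖v 0‖ • WithLp.ofLp (v 0) + Real.sinc ‖v 1‖ • WithLp.ofLp (v 1) - Real.sinc ‖v 2‖ • WithLp.ofLp (v 2)
        - Real.sinc ‖v 3‖ • WithLp.ofLp (v 3)) ≤ 16 * t ^ 2 := by
  set p : Fin 4 → (Fin 3 → ℝ) := fun i => Real.sinc ‖v i‖ • WithLp.ofLp (v i) with hp
  have hpt : ∀ c : Fin 3, (p 0 c + p 1 c - p 2 c - p 3 c) * (p 0 c + p 1 c - p 2 c - p 3 c) ≤
      4 * (p 0 c * p 0 c + p 1 c * p 1 c + p 2 c * p 2 c + p 3 c * p 3 c) := by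
    intro c
    nlinarith [sq_nonneg (p 0 c - p 1 c), sq_nonneg (p 0 c + p 2 c), sq_nonneg (p 0 c + p 3 c),
      sq_nonneg (p 1 c + p 2 c), sq_nonneg (p 1 c + p 3 c), sq_nonneg (p 2 c - p 3 c)]
  have hpp : ∀ i, p i ⬝ᵥ p i ≤ t ^ 2 := fun i =>
    (sinc_smul_dotProduct_self_le (v i)).trans (pow_le_pow_left₀ (norm_nonneg _) (hv i) 2)
  have hsum : (p 0 + p 1 - p 2 - p 3) ⬝ᵥ (p 0 + p 1 - p 2 - p 3) ≤ 4 * (p 0 ⬝ᵥ p 0 + p 1 ⬝ᵥ p 1 + p 2 ⬝ᵥ p 2 + p 3 ⬝ᵥ p 3) := by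
    simp only [dotProduct, Pi.add_apply, Pi.sub_apply, ← Finset.sum_add_distrib, Finset.mul_sum]
    exact Finset.sum_le_sum fun c _ => hpt c
  have h0 := hpp 0; have h1 := hpp 1; have h2 := hpp 2; have h3 := hpp 3
  show (p 0 + p 1 - p 2 - p 3) ⬝ᵥ (p 0 + p 1 - p 2 - p 3) ≤ 16 * t ^ 2
  linarith

/-- **Second-order remainder, crude form**: `|c(v) − s·s| ≤ 32t³ + 44t⁴` for `‖v_i‖ ≤ t ≤ 1` (w2's ✓`abs_plaquetteCost_sub_dot_le` + `|s| ≤ 4t`). -/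
theorem abs_cost_sub_sincCirc_sq_le (v : Fin 4 → E3) {t : ℝ} (ht1 : t ≤ 1) (hv : ∀ i, ‖v i‖ ≤ t) :
    |2 - (((expPauli (v 0) * expPauli (v 1) * (expPauli (v 2))⁻¹ * (expPauli (v 3))⁻¹ : SU2) : Matrix (Fin 2) (Fin 2) ℂ)).trace.re
      - (Real.sinc ‖v 0‖ • WithLp.ofLp (v 0) + Real.sinc ‖v 1‖ • WithLp.ofLp (v 1) - Real.sinc ‖v 2‖ • WithLp.ofLp (v 2)
          - Real.sinc ‖v 3‖ • WithLp.ofLp (v 3)) ⬝ᵥ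
        (Real.sinc ‖v 0‖ • WithLp.ofLp (v 0) + Real.sinc ‖v 1‖ • WithLp.ofLp (v 1) - Real.sinc ‖v 2‖ • WithLp.ofLp (v 2)
          - Real.sinc ‖v 3‖ • WithLp.ofLp (v 3))| ≤ 32 * t ^ 3 + 44 * t ^ 4 := by
  have ht0 : 0 ≤ t := (norm_nonneg _).trans (hv 0)
  have hw := PlaqCost.abs_plaquetteCost_sub_dot_le (v 0) (v 1) (v 2) (v 3) ht1 (hv 0) (hv 1) (hv 2) (hv 3)
  have hs := sincCirc_dotProduct_self_le v hv
  set s : Fin 3 → ℝ := Real.sinc ‖v 0‖ • WithLp.ofLp (v 0) + Real.sinc ‖v 1‖ • WithLp.ofLp (v 1)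
      - Real.sinc ‖v 2‖ • WithLp.ofLp (v 2) - Real.sinc ‖v 3‖ • WithLp.ofLp (v 3) with hs_def
  have hsqrt : Real.sqrt (s ⬝ᵥ s) ≤ 4 * t := by
    rw [show 4 * t = Real.sqrt ((4 * t) ^ 2) by rw [Real.sqrt_sq (by positivity)]]
    exact Real.sqrt_le_sqrt (by nlinarith)
  have hn : ‖v 0‖ + ‖v 1‖ + ‖v 2‖ + ‖v 3‖ ≤ 4 * t := by linarith [hv 0, hv 1, hv 2, hv 3]
  have hn2 : ‖v 0‖ ^ 2 + ‖v 1‖ ^ 2 + ‖v 2‖ ^ 2 + ‖v 3‖ ^ 2 ≤ 4 * t ^ 2 := by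
    have := fun i => pow_le_pow_left₀ (norm_nonneg _) (hv i) 2
    linarith [this 0, this 1, this 2, this 3]
  refine hw.trans ?_
  have hA : 2 * t * Real.sqrt (s ⬝ᵥ s) * (‖v 0‖ + ‖v 1‖ + ‖v 2‖ + ‖v 3‖) ≤ 2 * t * (4 * t) * (4 * t) := by
    refine mul_le_mul (mul_le_mul_of_nonneg_left hsqrt (by positivity)) hn (by positivity) (by positivity)
  have hB : 11 * t ^ 2 * (‖v 0‖ ^ 2 + ‖v 1‖ ^ 2 + ‖v 2‖ ^ 2 + ‖v 3‖ ^ 2) ≤ 11 * t ^ 2 * (4 * t ^ 2) :=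
    mul_le_mul_of_nonneg_left hn2 (by positivity)
  nlinarith

/-- **The odd part is cubic-small**: `|c_p^{odd}(a)| ≤ 32t³ + 44t⁴` when the four edge variables have norm `≤ t ≤ 1`
(the sinc-circulation square is even in `a`, so it cancels in `(c(a) − c(−a))/2`). -/
theorem abs_chartPlaqCostOdd_le (a : LandauFree H → E3) {t : ℝ} (ht1 : t ≤ 1) (hv : ∀ i, ‖plaqVar H x μ ν a i‖ ≤ t) :
    |chartPlaqCostOdd H x μ ν a| ≤ 32 * t ^ 3 + 44 * t ^ 4 := by
  have hv' : ∀ i, ‖(fun i => -plaqVar H x μ ν a i) i‖ ≤ t := fun i => by simpa only [norm_neg] using hv i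
  have h1 := abs_cost_sub_sincCirc_sq_le (plaqVar H x μ ν a) ht1 hv
  have h2 := abs_cost_sub_sincCirc_sq_le (fun i => -plaqVar H x μ ν a i) ht1 hv'
  simp only [norm_neg, WithLp.ofLp_neg, smul_neg] at h2
  have hss : ∀ s : Fin 3 → ℝ, (-s 0 + -s 1 - -s 2 - -s 3) = -(s 0 + s 1 - s 2 - s 3) := fun s => by ring
  unfold chartPlaqCostOdd
  rw [chartPlaqCost_eq_cost, chartPlaqCost_eq_cost]
  simp only [plaqVar_neg]
  rw [abs_le] at h1 h2 ⊢
  have e : ∀ p₀ p₁ p₂ p₃ : Fin 3 → ℝ, (-p₀ + -p₁ - -p₂ - -p₃) ⬝ᵥ (-p₀ + -p₁ - -p₂ - -p₃) = (p₀ + p₁ - p₂ - p₃) ⬝ᵥ (p₀ + p₁ - p₂ - p₃) := by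
    intro p₀ p₁ p₂ p₃
    rw [show (-p₀ + -p₁ - -p₂ - -p₃) = -(p₀ + p₁ - p₂ - p₃) by abel, neg_dotProduct, dotProduct_neg, neg_neg]
  rw [e] at h2
  constructor <;> linarith [h1.1, h1.2, h2.1, h2.2]

/-- **Pointwise dominator of `(c_p^{odd})²`**: `(c_p^{odd})² ≤ 5776·S³`, `S = Σ_i ‖v_i‖²` (case `S ≤ 1`: `t = √S`; case `S > 1`: `|c^{odd}| ≤ 4`). -/
theorem chartPlaqCostOdd_sq_le (a : LandauFree H → E3) :
    chartPlaqCostOdd H x μ ν a ^ 2 ≤ 5776 * (∑ i : Fin 4, ‖plaqVar H x μ ν a i‖ ^ 2) ^ 3 := by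
  set S := ∑ i : Fin 4, ‖plaqVar H x μ ν a i‖ ^ 2 with hS
  have hS0 : 0 ≤ S := Finset.sum_nonneg fun i _ => sq_nonneg _
  have hvi : ∀ i, ‖plaqVar H x μ ν a i‖ ≤ Real.sqrt S := fun i => by
    refine Real.le_sqrt_of_sq_le ?_
    exact Finset.single_le_sum (f := fun i => ‖plaqVar H x μ ν a i‖ ^ 2) (fun i _ => sq_nonneg _) (Finset.mem_univ i)
  have h4 := abs_chartPlaqCostOdd_le_four H x μ ν a
  rcases le_or_gt S 1 with hS1 | hS1
  · have ht1 : Real.sqrt S ≤ 1 := Real.sqrt_le_one.mpr hS1 |>.trans_eq' rfl |> fun h => by simpa using Real.sqrt_le_sqrt hS1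
    have h := abs_chartPlaqCostOdd_le H x μ ν a ht1 hvi
    have hs2 : Real.sqrt S ^ 2 = S := Real.sq_sqrt hS0
    have hs3 : Real.sqrt S ^ 3 ≤ Real.sqrt S ^ 2 * 1 := by
      rw [pow_succ]; exact mul_le_mul_of_nonneg_left ht1 (sq_nonneg _)
    have hs4 : Real.sqrt S ^ 4 ≤ Real.sqrt S ^ 2 * 1 := by
      rw [show (4 : ℕ) = 2 + 2 from rfl, pow_add]
      exact mul_le_mul_of_nonneg_left (by nlinarith [Real.sqrt_nonneg S]) (sq_nonneg _)
    have hodd : |chartPlaqCostOdd H x μ ν a| ≤ 76 * Real.sqrt S ^ 3 := by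
      have : Real.sqrt S ^ 4 ≤ Real.sqrt S ^ 3 := by
        rw [pow_succ]; exact mul_le_of_le_one_right (pow_nonneg (Real.sqrt_nonneg _) 3) ht1
      linarith
    have hsq : chartPlaqCostOdd H x μ ν a ^ 2 ≤ (76 * Real.sqrt S ^ 3) ^ 2 := by
      rw [← sq_abs]; exact pow_le_pow_left₀ (abs_nonneg _) hodd 2
    calc chartPlaqCostOdd H x μ ν a ^ 2 ≤ (76 * Real.sqrt S ^ 3) ^ 2 := hsq
      _ = 5776 * (Real.sqrt S ^ 2) ^ 3 := by ring
      _ = 5776 * S ^ 3 := by rw [hs2]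
  · have hsq : chartPlaqCostOdd H x μ ν a ^ 2 ≤ 4 ^ 2 := by
      rw [← sq_abs]; exact pow_le_pow_left₀ (abs_nonneg _) h4 2
    have hS3 : 1 ≤ S ^ 3 := one_le_pow₀ hS1.le
    linarith


/-! ## The even remainder (modulo T-S5.7a) -/

/-- `c_p⁽²⁾ = |ℓ_p|²` is the squared norm of the signed edge sum (✓`QuadSplit.linCurv_eq_plaqLin`). -/
theorem linCurvSq_eq_norm_plaqLin_sq (a : LandauFree H → E3) :
    linCurvSq H (x, μ, ν) a = ‖plaqLin (plaqVar H x μ ν a)‖ ^ 2 := by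
  rw [linCurvSq, EuclideanSpace.norm_sq_eq]
  refine Finset.sum_congr rfl fun c _ => ?_
  rw [QuadSplit.linCurv_eq_plaqLin, Real.norm_eq_abs, sq_abs]

/-- `|ℓ_p|² ≤ 4S`. -/
theorem norm_plaqLin_sq_le (v : Fin 4 → E3) : ‖plaqLin v‖ ^ 2 ≤ 4 * ∑ i : Fin 4, ‖v i‖ ^ 2 := by
  have h : ‖plaqLin v‖ ≤ ‖v 0‖ + ‖v 1‖ + ‖v 2‖ + ‖v 3‖ := by
    unfold plaqLin
    calc ‖v 0 + v 1 - v 2 - v 3‖ ≤ ‖v 0 + v 1 - v 2‖ + ‖v 3‖ := norm_sub_le _ _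
      _ ≤ ‖v 0 + v 1‖ + ‖v 2‖ + ‖v 3‖ := by gcongr; exact norm_sub_le _ _
      _ ≤ ‖v 0‖ + ‖v 1‖ + ‖v 2‖ + ‖v 3‖ := by gcongr; exact norm_add_le _ _
  have hsum : ∑ i : Fin 4, ‖v i‖ ^ 2 = ‖v 0‖ ^ 2 + ‖v 1‖ ^ 2 + ‖v 2‖ ^ 2 + ‖v 3‖ ^ 2 := by
    simp [Fin.sum_univ_four]
  rw [hsum]
  have h0 := norm_nonneg (plaqLin v)
  nlinarith [norm_nonneg (v 0), norm_nonneg (v 1), norm_nonneg (v 2), norm_nonneg (v 3),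
    sq_nonneg (‖v 0‖ - ‖v 1‖), sq_nonneg (‖v 0‖ - ‖v 2‖), sq_nonneg (‖v 0‖ - ‖v 3‖),
    sq_nonneg (‖v 1‖ - ‖v 2‖), sq_nonneg (‖v 1‖ - ‖v 3‖), sq_nonneg (‖v 2‖ - ‖v 3‖)]

/-- **Pointwise dominator of the even remainder** from the quartic expansion of T-S5.7a (first clause, taken as a hypothesis):
`(c_p − |ℓ_p|² − c_p^{odd})² ≤ (C² + 144)·S⁴`. -/
theorem evenRem_sq_le {C : ℝ}
    (h7 : ∀ (t : ℝ) (a : LandauFree H → E3), 0 ≤ t → t ≤ 1 → (∀ i, ‖plaqVar H x μ ν a i‖ ≤ t) →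
      |chartPlaqCost H x μ ν a - ‖plaqLin (plaqVar H x μ ν a)‖ ^ 2 - chartPlaqCostOdd H x μ ν a| ≤ C * t ^ 4)
    (a : LandauFree H → E3) :
    (chartPlaqCost H x μ ν a - ‖plaqLin (plaqVar H x μ ν a)‖ ^ 2 - chartPlaqCostOdd H x μ ν a) ^ 2 ≤
      (C ^ 2 + 144) * (∑ i : Fin 4, ‖plaqVar H x μ ν a i‖ ^ 2) ^ 4 := by
  set S := ∑ i : Fin 4, ‖plaqVar H x μ ν a i‖ ^ 2 with hS
  set R := chartPlaqCost H x μ ν a - ‖plaqLin (plaqVar H x μ ν a)‖ ^ 2 - chartPlaqCostOdd H x μ ν a with hR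
  have hS0 : 0 ≤ S := Finset.sum_nonneg fun i _ => sq_nonneg _
  have hvi : ∀ i, ‖plaqVar H x μ ν a i‖ ≤ Real.sqrt S := fun i => by
    refine Real.le_sqrt_of_sq_le ?_
    exact Finset.single_le_sum (f := fun i => ‖plaqVar H x μ ν a i‖ ^ 2) (fun i _ => sq_nonneg _) (Finset.mem_univ i)
  have hS4 : 0 ≤ S ^ 4 := by positivity
  rcases le_or_gt S 1 with hS1 | hS1
  · have ht1 : Real.sqrt S ≤ 1 := by simpa using Real.sqrt_le_sqrt hS1
    have h := h7 (Real.sqrt S) a (Real.sqrt_nonneg _) ht1 hvi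
    have hs4 : Real.sqrt S ^ 4 = S ^ 2 := by
      rw [show (4 : ℕ) = 2 * 2 from rfl, pow_mul, Real.sq_sqrt hS0]
    rw [hs4] at h
    have hsq : R ^ 2 ≤ (C * S ^ 2) ^ 2 := by
      rw [← sq_abs]; exact pow_le_pow_left₀ (abs_nonneg _) h 2
    calc R ^ 2 ≤ (C * S ^ 2) ^ 2 := hsq
      _ = C ^ 2 * S ^ 4 := by ring
      _ ≤ (C ^ 2 + 144) * S ^ 4 := by nlinarith
  · have hc := abs_chartPlaqCost_le H x μ ν a
    have ho := abs_chartPlaqCostOdd_le_four H x μ ν a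
    have hl := norm_plaqLin_sq_le (plaqVar H x μ ν a)
    have hRabs : |R| ≤ 12 * S := by
      rw [hR, abs_le] at *
      have hl0 : 0 ≤ ‖plaqLin (plaqVar H x μ ν a)‖ ^ 2 := sq_nonneg _
      constructor <;> nlinarith [hc.1, hc.2, ho.1, ho.2]
    have hsq : R ^ 2 ≤ (12 * S) ^ 2 := by
      rw [← sq_abs]; exact pow_le_pow_left₀ (abs_nonneg _) hRabs 2
    have hS2 : S ^ 2 ≤ S ^ 4 := pow_le_pow_right₀ hS1.le (by norm_num)
    nlinarith [sq_nonneg C]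

/-! ## The Gaussian sizes -/

/-- ★ **Clause (ii), unconditional**: `E₀[(c_p^{odd})²] ≤ 2888·(C₂ + C₄)/β³` with `C₂ = 60·1036²`, `C₄ = 81·C₂²`. -/
theorem gaussAvg_chartPlaqCostOdd_sq_le {β : ℝ} (hβ : 0 < β) :
    gaussAvg β H (fun a => chartPlaqCostOdd H x μ ν a ^ 2) ≤
      2888 * (60 * 1036 ^ 2 + 81 * (60 * 1036 ^ 2) ^ 2) / β ^ 3 := by
  -- pointwise: `(c^{odd})² ≤ 5776 S³ ≤ 2888 (β⁻¹ S² + β S⁴)`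
  have hpt : ∀ a : LandauFree H → E3, chartPlaqCostOdd H x μ ν a ^ 2 ≤
      2888 * β⁻¹ * (∑ i : Fin 4, ‖plaqVar H x μ ν a i‖ ^ 2) ^ 2 + 2888 * β * (∑ i : Fin 4, ‖plaqVar H x μ ν a i‖ ^ 2) ^ 4 := by
    intro a
    have h := chartPlaqCostOdd_sq_le H x μ ν a
    set S := ∑ i : Fin 4, ‖plaqVar H x μ ν a i‖ ^ 2
    have hS0 : 0 ≤ S := Finset.sum_nonneg fun i _ => sq_nonneg _
    -- AM–GM: `2 S³ ≤ β⁻¹ S² + β S⁴` since `β⁻¹S² + βS⁴ − 2S³ = β⁻¹ S² (βS − 1)²`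
    have hamgm : 2 * S ^ 3 ≤ β⁻¹ * S ^ 2 + β * S ^ 4 := by
      have e : β⁻¹ * S ^ 2 + β * S ^ 4 - 2 * S ^ 3 = β⁻¹ * (S * (β * S - 1)) ^ 2 := by field_simp; ring
      nlinarith [mul_nonneg (inv_nonneg.mpr hβ.le) (sq_nonneg (S * (β * S - 1)))]
    nlinarith
  have hint2 := integrable_edgeSq_pow_mul_gaussWeight H hβ x μ ν 2
  have hint4 := integrable_edgeSq_pow_mul_gaussWeight H hβ x μ ν 4
  have hint : Integrable (fun a : LandauFree H → E3 =>
      (2888 * β⁻¹ * (∑ i : Fin 4, ‖plaqVar H x μ ν a i‖ ^ 2) ^ 2 + 2888 * β * (∑ i : Fin 4, ‖plaqVar H x μ ν a i‖ ^ 2) ^ 4) *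
        gaussWeight β H a) := by
    have h := (hint2.const_mul (2888 * β⁻¹)).add (hint4.const_mul (2888 * β))
    refine h.congr (Filter.Eventually.of_forall fun a => ?_)
    simp only [Pi.add_apply]; ring
  have hi2 : Integrable (fun a : LandauFree H → E3 =>
      2888 * β⁻¹ * (∑ i : Fin 4, ‖plaqVar H x μ ν a i‖ ^ 2) ^ 2 * gaussWeight β H a) :=
    (hint2.const_mul (2888 * β⁻¹)).congr (Filter.Eventually.of_forall fun a => by ring)
  have hi4 : Integrable (fun a : LandauFree H → E3 =>
      2888 * β * (∑ i : Fin 4, ‖plaqVar H x μ ν a i‖ ^ 2) ^ 4 * gaussWeight β H a) :=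
    (hint4.const_mul (2888 * β)).congr (Filter.Eventually.of_forall fun a => by ring)
  have h2 := gaussAvg_edgeSq_sq_le H hβ x μ ν
  have h4 := gaussAvg_edgeSq_pow_four_le H hβ x μ ν
  calc gaussAvg β H (fun a => chartPlaqCostOdd H x μ ν a ^ 2)
      ≤ gaussAvg β H (fun a => 2888 * β⁻¹ * (∑ i : Fin 4, ‖plaqVar H x μ ν a i‖ ^ 2) ^ 2 +
          2888 * β * (∑ i : Fin 4, ‖plaqVar H x μ ν a i‖ ^ 2) ^ 4) := gaussAvg_mono H hβ (fun a => sq_nonneg _) hpt hint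
    _ = 2888 * β⁻¹ * gaussAvg β H (fun a => (∑ i : Fin 4, ‖plaqVar H x μ ν a i‖ ^ 2) ^ 2) +
          2888 * β * gaussAvg β H (fun a => (∑ i : Fin 4, ‖plaqVar H x μ ν a i‖ ^ 2) ^ 4) := by
        rw [gaussAvg_add H _ _ hi2 hi4, gaussAvg_const_mul, gaussAvg_const_mul]
    _ ≤ 2888 * β⁻¹ * (60 * 1036 ^ 2 / β ^ 2) + 2888 * β * (81 * (60 * 1036 ^ 2) ^ 2 / β ^ 4) := by
        gcongr
    _ = 2888 * (60 * 1036 ^ 2 + 81 * (60 * 1036 ^ 2) ^ 2) / β ^ 3 := by field_simp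

/-- ★ **Clause (iii), modulo the quartic expansion of T-S5.7a**: `E₀[(c_p − |ℓ_p|² − c_p^{odd})²] ≤ (C² + 144)·C₄/β⁴`. -/
theorem gaussAvg_evenRem_sq_le {β : ℝ} (hβ : 0 < β) {C : ℝ}
    (h7 : ∀ (t : ℝ) (a : LandauFree H → E3), 0 ≤ t → t ≤ 1 → (∀ i, ‖plaqVar H x μ ν a i‖ ≤ t) →
      |chartPlaqCost H x μ ν a - ‖plaqLin (plaqVar H x μ ν a)‖ ^ 2 - chartPlaqCostOdd H x μ ν a| ≤ C * t ^ 4) :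
    gaussAvg β H (fun a => (chartPlaqCost H x μ ν a - ‖plaqLin (plaqVar H x μ ν a)‖ ^ 2 - chartPlaqCostOdd H x μ ν a) ^ 2) ≤
      (C ^ 2 + 144) * (81 * (60 * 1036 ^ 2) ^ 2) / β ^ 4 := by
  have hint4 := integrable_edgeSq_pow_mul_gaussWeight H hβ x μ ν 4
  have hint : Integrable (fun a : LandauFree H → E3 =>
      ((C ^ 2 + 144) * (∑ i : Fin 4, ‖plaqVar H x μ ν a i‖ ^ 2) ^ 4) * gaussWeight β H a) := by
    have h := hint4.const_mul (C ^ 2 + 144)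
    refine h.congr (Filter.Eventually.of_forall fun a => ?_)
    ring
  have h4 := gaussAvg_edgeSq_pow_four_le H hβ x μ ν
  have hC : 0 ≤ C ^ 2 + 144 := by positivity
  calc gaussAvg β H (fun a => (chartPlaqCost H x μ ν a - ‖plaqLin (plaqVar H x μ ν a)‖ ^ 2 - chartPlaqCostOdd H x μ ν a) ^ 2)
      ≤ gaussAvg β H (fun a => (C ^ 2 + 144) * (∑ i : Fin 4, ‖plaqVar H x μ ν a i‖ ^ 2) ^ 4) :=
        gaussAvg_mono H hβ (fun a => sq_nonneg _) (evenRem_sq_le H x μ ν h7) hint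
    _ = (C ^ 2 + 144) * gaussAvg β H (fun a => (∑ i : Fin 4, ‖plaqVar H x μ ν a i‖ ^ 2) ^ 4) := gaussAvg_const_mul H _ _
    _ ≤ (C ^ 2 + 144) * (81 * (60 * 1036 ^ 2) ^ 2 / β ^ 4) := mul_le_mul_of_nonneg_left h4 hC
    _ = (C ^ 2 + 144) * (81 * (60 * 1036 ^ 2) ^ 2) / β ^ 4 := by ring

end PlaqObsL2

open PlaqObsL2 in
/-- **T-S5.12d `PlaquetteObsL2` modulo T-S5.7a**: the three Gaussian `L²` sizes of one plaquette observable — `E₀[(c_p⁽²⁾)²] ≤ C/β²`,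
`E₀[(c_p^{odd})²] ≤ C/β³`, `E₀[(c_p − c_p⁽²⁾ − c_p^{odd})²] ≤ C/β⁴` for `H ≥ 1`, `β ≥ 1`, every base point — given the quartic plaquette expansion
`WilsonPlaquetteTaylor` (only its even first clause is used; clauses (i) and (ii) are unconditional: ✓`PlaqObsL4.gaussAvg_linCurvSq_sq_le`,
`PlaqObsL2.gaussAvg_chartPlaqCostOdd_sq_le`). -/
theorem plaquetteObsL2_of (h7a : WilsonPlaquetteTaylor) : PlaquetteObsL2 := by
  obtain ⟨C7, hC7⟩ := h7a
  obtain ⟨T, -, hT⟩ := hC7 1 2 (by decide)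
  set Codd : ℝ := 2888 * (60 * 1036 ^ 2 + 81 * (60 * 1036 ^ 2) ^ 2) with hCodd
  set Crem : ℝ := (C7 ^ 2 + 144) * (81 * (60 * 1036 ^ 2) ^ 2) with hCrem
  refine ⟨max (15 / 4) (max Codd Crem), fun H hH β hβ x => ?_⟩
  have hβ0 : 0 < β := lt_of_lt_of_le one_pos hβ
  refine ⟨?_, ?_, ?_⟩
  · exact (PlaqObsL4.gaussAvg_linCurvSq_sq_le H hH hβ0 x).trans
      (div_le_div_of_nonneg_right (le_max_left _ _) (by positivity))
  · exact (gaussAvg_chartPlaqCostOdd_sq_le H x 1 2 hβ0).trans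
      (div_le_div_of_nonneg_right ((le_max_left _ _).trans (le_max_right _ _)) (by positivity))
  · have e : ∀ a : LandauFree H → E3, linCurvSq H (plaq12At x) a = ‖plaqLin (plaqVar H x 1 2 a)‖ ^ 2 :=
      fun a => linCurvSq_eq_norm_plaqLin_sq H x 1 2 a
    simp only [e]
    have h7 : ∀ (t : ℝ) (a : LandauFree H → E3), 0 ≤ t → t ≤ 1 → (∀ i, ‖plaqVar H x 1 2 a i‖ ≤ t) →
        |chartPlaqCost H x 1 2 a - ‖plaqLin (plaqVar H x 1 2 a)‖ ^ 2 - chartPlaqCostOdd H x 1 2 a| ≤ C7 * t ^ 4 :=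
      fun t a ht0 ht1 hv => (hT H x t a ht0 ht1 hv).1
    exact (gaussAvg_evenRem_sq_le H x 1 2 hβ0 h7).trans
      (div_le_div_of_nonneg_right ((le_max_right _ _).trans (le_max_right _ _)) (by positivity))

end Summit.QuantumFields.YangMills.Theorems.AllWindowsColdBoxBoxHighLine

end
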